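import Summits.QuantumFields.YangMills.Theorems.ComplexCouplingChannelComplexStrongCouplingAnchor
import Summits.QuantumFields.YangMills.Theorems.ComplexCouplingChannelFreeEnergyWindowChannelStubChainOnCompacts
import Summits.QuantumFields.YangMills.Theorems.ComplexCouplingChannelFreeEnergyWindowChannelStubWindowOnCompacts
import Summits.QuantumFields.YangMills.Theorems.ComplexCouplingChannelFreeEnergyWindowChannelStubConnectedCompactJoin
import Summits.QuantumFields.YangMills.Theorems.ComplexCouplingChannelFreeEnergyWindowChannelStubLocalWindowOfEnvelope
import Literature.MathematicalPhysics.QuantumFieldTheory.WilsonFinTorusPartitionComplex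

/-!
# The envelope criterion for `FreeEnergyWindowChannel` (`stub_envelopeCriterion`)

Stub `stub_envelopeCriterion` of the crux `FreeEnergyWindowChannel` (stmt-QuantumFields-18842, route
`ComplexCouplingChannel` of `QuantumFields/YangMills`), line `Sketch` (idea `upper-envelope-suffices`).

The crux asks, for every compact simple `G` and faithful unitary `r`, beyond some `β₁`, for every `β ≥ β₁` and
`ρ > 0`, for an open connected complex-coupling channel `D ∋ β` meeting `(−ρ, ρ)` at a real point `x`, one
holomorphic `f` on `D`, and `M, P₀` such that the symmetric-torus Wilson partition functions
`Z_P(z) = wilsonFinTorusPartitionC r.ρ z P P P P` (`P ≥ P₀`) are ZERO-FREE on `D` with the TWO-SIDED window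
`|log ‖Z_P z‖ + P⁴ Re f z| ≤ M`.  THIS FILE PROVES (sorry-free, over the proved strong-coupling anchor
`complexStrongCouplingAnchor_proof` and the landed converters of the line) that the crux is EQUIVALENT to the
ONE-SIDED statement C⁺⁺ with the same binders and the conclusion

* FLOOR at the single real point `x`:  `log ‖Z_P x‖ + P⁴ Re f x ≥ −M`  (`P ≥ P₀`), and
* ENVELOPE on `D`:  `‖Z_P(z) · exp (P⁴ f z)‖ ≤ e^M`  (`P ≥ P₀`, `z ∈ D`),

— no zero-freeness, no lower bound off the point `x`, no logarithm of a possibly vanishing quantity — and that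
the PURE ENVELOPE statement E (a channel through `0` itself, `f 0 = 0`, envelope only) implies the crux (at
`x = 0` the floor is free: `Z_P 0 = 1`).  Mechanism (C⁺⁺ ⇒ crux, `windowAt_of_envelopeFloor`): the local converter
`stub_localWindowOfEnvelope` (floor at the centre + envelope on a ball ⇒ zero-free two-sided window on a smaller
ball; Schwarz bound + Borel–Carathéodory) pins `f` near `x`; the global converter `stub_windowOnCompacts` ∘
`stub_chainOnCompacts` (holomorphic logarithm and Borel–Carathéodory on the anchor disc, `Re f = Re f_A` near `x`,
two-constants estimate along Hadamard three-circles disc chains against the envelope bound `e^M + 1`, uniform on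
compacts) gives the zero-free window with constant `1` on every compact `K ⊆ D` for `P ≥ P₁(K)`; and
`stub_connectedCompactJoin` supplies an open connected `D' ∋ x, β` inside such a `K`.  So every proof of the
crux need only bound the oscillatory Haar integral `Z_P(z)` FROM ABOVE along a channel (plus one real-point floor,
which reflection positivity is expected to supply); zero-freeness is output, not input.

References: R. Nevanlinna, *Eindeutige analytische Funktionen* (1936) §III.2 (two-constants theorem); the
route file `Summits/QuantumFields/YangMills/Theses/ComplexCouplingChannel.lean`; the line file
`Summits/QuantumFields/YangMills/Cruxes/FreeEnergyWindowChannel/Lines/Sketch.lean`.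
-/

open MeasureTheory Complex Metric Set

namespace Summit.QuantumFields.YangMills.Theorems.FreeEnergyWindowChannel

/-- C⁺⁺-data ⇒ the crux's conclusion at `β` for one `(G, r)` (sorry-free): the floor at the real point `x` plus the
envelope on a ball around `x` pin the continuation (`stub_localWindowOfEnvelope` at `t = x`; `Z_P x > 0`), the
landed global converter (`stub_windowOnCompacts` ∘ `stub_chainOnCompacts`, anchor data `hanchor` on `ball 0 ρ₀`,
`|x| < ρ₀`) gives the zero-free window with `M = 1` on every compact `K ⊆ D`, and the landed join
`stub_connectedCompactJoin` an open connected `D' ∋ x, β` inside such a `K`. -/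
theorem windowAt_of_envelopeFloor (G : Type) [Group G] [TopologicalSpace G] [IsTopologicalGroup G] [CompactSpace G]
    [MeasurableSpace G] [BorelSpace G]
    (r : Literature.MathematicalPhysics.QuantumFieldTheory.LatticeRep G) {ρ₀ : ℝ}
    (hanchor : ∃ c : ℝ, 0 < c ∧ ∃ fA : ℂ → ℂ, DifferentiableOn ℂ fA (Metric.ball 0 ρ₀) ∧ ∃ C : ℝ,
      ∀ P : ℕ, 1 ≤ P → ∀ z : ℂ, ‖z‖ < ρ₀ →
        Literature.MathematicalPhysics.QuantumFieldTheory.wilsonFinTorusPartitionC r.ρ z P P P P ≠ 0 ∧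
        |Real.log ‖Literature.MathematicalPhysics.QuantumFieldTheory.wilsonFinTorusPartitionC r.ρ z P P P P‖ +
          (P : ℝ) ^ 4 * (fA z).re| ≤ C * (P : ℝ) ^ 4 * Real.exp (-(c * P)))
    {D : Set ℂ} (hDo : IsOpen D) (hDc : IsConnected D) {β : ℝ} (hβD : (β : ℂ) ∈ D)
    {x : ℝ} (hxρ₀ : |x| < ρ₀) (hxD : (x : ℂ) ∈ D)
    {f : ℂ → ℂ} (hf : DifferentiableOn ℂ f D) {M : ℝ} {P₀ : ℕ}
    (hfl : ∀ P : ℕ, P₀ ≤ P →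
      -M ≤ Real.log ‖Literature.MathematicalPhysics.QuantumFieldTheory.wilsonFinTorusPartitionC r.ρ (x : ℂ) P P P P‖ +
        (P : ℝ) ^ 4 * (f (x : ℂ)).re)
    (henv : ∀ P : ℕ, P₀ ≤ P → ∀ z ∈ D,
      ‖Literature.MathematicalPhysics.QuantumFieldTheory.wilsonFinTorusPartitionC r.ρ z P P P P *
        Complex.exp ((P : ℂ) ^ 4 * f z)‖ ≤ Real.exp M) :
    ∃ D' : Set ℂ, D' ⊆ D ∧ IsOpen D' ∧ IsConnected D' ∧ (β : ℂ) ∈ D' ∧ (x : ℂ) ∈ D' ∧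
      ∃ P₁ : ℕ, ∀ P : ℕ, P₁ ≤ P → ∀ z ∈ D',
        Literature.MathematicalPhysics.QuantumFieldTheory.wilsonFinTorusPartitionC r.ρ z P P P P ≠ 0 ∧
        |Real.log ‖Literature.MathematicalPhysics.QuantumFieldTheory.wilsonFinTorusPartitionC r.ρ z P P P P‖ +
          (P : ℝ) ^ 4 * (f z).re| ≤ 1 := by
  haveI : SecondCountableTopology G :=
    (r.continuous.isClosedEmbedding r.injective).isEmbedding.secondCountableTopology
  -- the family
  set Z : ℕ → ℂ → ℂ := fun P z =>
    Literature.MathematicalPhysics.QuantumFieldTheory.wilsonFinTorusPartitionC r.ρ z P P P P with hZ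
  have hZd : ∀ P : ℕ, Differentiable ℂ (Z P) := fun P =>
    Literature.MathematicalPhysics.QuantumFieldTheory.differentiable_wilsonFinTorusPartitionC r.ρ r.continuous P P P P
  have hZ1 : ∀ P : ℕ, Z P 0 = 1 := fun P =>
    Literature.MathematicalPhysics.QuantumFieldTheory.wilsonFinTorusPartitionC_zero r.ρ P P P P
  have hZx : ∀ P : ℕ, Z P (x : ℂ) ≠ 0 := fun P => by
    simp only [hZ, Literature.MathematicalPhysics.QuantumFieldTheory.wilsonFinTorusPartitionC_ofReal, ne_eq,
      Complex.ofReal_eq_zero]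
    exact (Literature.MathematicalPhysics.QuantumFieldTheory.wilsonFinTorusPartition_pos r.continuous x P P P P).ne'
  have henv' : ∀ P : ℕ, P₀ ≤ P → ∀ z ∈ D, ‖Z P z * Complex.exp ((P : ℂ) ^ 4 * f z)‖ ≤ Real.exp M :=
    fun P hP z hz => henv P hP z hz
  obtain ⟨c, hc, fA, hfA, C, hA⟩ := hanchor
  have hρ₀ : 0 < ρ₀ := lt_of_le_of_lt (abs_nonneg x) hxρ₀
  have hA' : ∀ P : ℕ, 1 ≤ P → ∀ z : ℂ, ‖z‖ < ρ₀ → Z P z ≠ 0 ∧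
      |Real.log ‖Z P z‖ + (P : ℝ) ^ 4 * (fA z).re| ≤ C * (P : ℝ) ^ 4 * Real.exp (-(c * P)) :=
    fun P hP z hz => hA P hP z hz
  -- pinning at `x` by the local converter
  obtain ⟨δ₀, hδ₀, hδ₀D⟩ : ∃ δ₀ : ℝ, 0 < δ₀ ∧ Metric.ball (x : ℂ) δ₀ ⊆ D := Metric.isOpen_iff.1 hDo _ hxD
  have hfloor : ∀ P : ℕ, P₀ ≤ P → Z P (x : ℂ) ≠ 0 ∧ -M ≤ Real.log ‖Z P (x : ℂ)‖ + (P : ℝ) ^ 4 * (f (x : ℂ)).re :=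
    fun P hP => ⟨hZx P, hfl P hP⟩
  obtain ⟨δ', hδ', hδ'δ, M', hpin⟩ :=
    Summit.QuantumFields.YangMills.Theorems.FreeEnergyWindowChannel.stub_localWindowOfEnvelope Z x δ₀ M P₀ hδ₀
      (fun P => (hZd P).differentiableOn) f (hf.mono hδ₀D) hfloor (fun P hP z hz => henv' P hP z (hδ₀D hz))
  have hballD : Metric.ball (x : ℂ) δ' ⊆ D := (Metric.ball_subset_ball hδ'δ).trans hδ₀D
  -- the global converter on compacts (landed stubs), with the common constant `max M M'`
  set M₁ : ℝ := max M M' with hM₁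
  have hpin₁ : ∃ δ : ℝ, 0 < δ ∧ Metric.ball (x : ℂ) δ ⊆ D ∧ ∀ P : ℕ, P₀ ≤ P → ∀ z ∈ Metric.ball (x : ℂ) δ,
      Z P z ≠ 0 ∧ |Real.log ‖Z P z‖ + (P : ℝ) ^ 4 * (f z).re| ≤ M₁ :=
    ⟨δ', hδ', hballD, fun P hP z hz => ⟨(hpin P hP z hz).1, (hpin P hP z hz).2.trans (le_max_right _ _)⟩⟩
  have henv₁ : ∀ P : ℕ, P₀ ≤ P → ∀ z ∈ D, ‖Z P z * Complex.exp ((P : ℂ) ^ 4 * f z)‖ ≤ Real.exp M₁ :=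
    fun P hP z hz => (henv' P hP z hz).trans (Real.exp_le_exp.2 (le_max_left _ _))
  have hx0 : ‖(x : ℂ)‖ < ρ₀ := by rw [Complex.norm_real, Real.norm_eq_abs]; exact hxρ₀
  obtain ⟨D', K, hD'o, hD'c, hK, hxD', hβD', hD'K, hKD⟩ :=
    Summit.QuantumFields.YangMills.Theorems.FreeEnergyWindowChannel.stub_connectedCompactJoin D hDo hDc
      (x : ℂ) hxD (β : ℂ) hβD
  obtain ⟨P₁, hP₁⟩ :=
    Summit.QuantumFields.YangMills.Theorems.FreeEnergyWindowChannel.stub_windowOnCompacts Z ρ₀ c C hρ₀ hc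
      (fun P => (hZd P).differentiableOn) hZ1 fA hfA hA' D hDo hDc (fun P => (hZd P).differentiableOn)
      (x : ℂ) hx0 hxD
      (fun r₀ hr₀ K' hK' hK'D =>
        Summit.QuantumFields.YangMills.Theorems.FreeEnergyWindowChannel.stub_chainOnCompacts D hDo
          hDc.isPreconnected (x : ℂ) hxD r₀ hr₀ K' hK' hK'D)
      f hf M₁ P₀ hpin₁ henv₁ K hK hKD
  exact ⟨D', hD'K.trans hKD, hD'o, hD'c, hβD', hxD', P₁, fun P hP z hz => hP₁ P hP z (hD'K hz)⟩

/-- THE CONVERSE (trivial direction of the equivalence crux ⇔ C⁺⁺): the crux's zero-free two-sided window gives the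
floor at `x` and the envelope on `D` with the same `D, x, f, M, P₀` (`‖Z e^{P⁴ f}‖ = exp (log ‖Z‖ + P⁴ Re f)`). -/
theorem envelopeFloor_of_crux
    (h : Summit.QuantumFields.YangMills.Theses.ComplexCouplingChannel.FreeEnergyWindowChannel) :
    ∀ (G : Type) [Group G] [TopologicalSpace G] [IsTopologicalGroup G] [CompactSpace G] [MeasurableSpace G] [BorelSpace G], Literature.MathematicalPhysics.QuantumFieldTheory.IsCompactSimpleLieGroup G → ∀ r : Literature.MathematicalPhysics.QuantumFieldTheory.LatticeRep G,
    ∃ β₁ : ℝ, ∀ β : ℝ, β₁ ≤ β → ∀ ρ : ℝ, 0 < ρ →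
      ∃ D : Set ℂ, IsOpen D ∧ IsConnected D ∧ (β : ℂ) ∈ D ∧
        ∃ x : ℝ, |x| < ρ ∧ (x : ℂ) ∈ D ∧
        ∃ f : ℂ → ℂ, DifferentiableOn ℂ f D ∧ ∃ M : ℝ, ∃ P₀ : ℕ,
          (∀ P : ℕ, P₀ ≤ P →
            -M ≤ Real.log ‖Literature.MathematicalPhysics.QuantumFieldTheory.wilsonFinTorusPartitionC r.ρ (x : ℂ) P P P P‖ +
              (P : ℝ) ^ 4 * (f (x : ℂ)).re) ∧
          ∀ P : ℕ, P₀ ≤ P → ∀ z ∈ D,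
            ‖Literature.MathematicalPhysics.QuantumFieldTheory.wilsonFinTorusPartitionC r.ρ z P P P P *
              Complex.exp ((P : ℂ) ^ 4 * f z)‖ ≤ Real.exp M := by
  intro G _ _ _ _ _ _ hG r
  obtain ⟨β₁, hβ₁⟩ := h G hG r
  refine ⟨β₁, fun β hβ ρ hρ => ?_⟩
  obtain ⟨D, hDo, hDc, hβD, ⟨x, hxρ, hxD⟩, f, hf, M, P₀, hwin⟩ := hβ₁ β hβ ρ hρ
  refine ⟨D, hDo, hDc, hβD, x, hxρ, hxD, f, hf, M, P₀, fun P hP => ?_, fun P hP z hz => ?_⟩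
  · have h1 := (hwin P hP (x : ℂ) hxD).2
    exact (abs_le.1 h1).1
  · obtain ⟨hz0, hzb⟩ := hwin P hP z hz
    have hz0' : Literature.MathematicalPhysics.QuantumFieldTheory.wilsonFinTorusPartitionC r.ρ z P P P P ≠ 0 := hz0
    have hzb' : |Real.log ‖Literature.MathematicalPhysics.QuantumFieldTheory.wilsonFinTorusPartitionC r.ρ z P P P P‖ +
        (P : ℝ) ^ 4 * (f z).re| ≤ M := hzb
    have hre : ((P : ℂ) ^ 4 * f z).re = (P : ℝ) ^ 4 * (f z).re := by
      rw [show ((P : ℂ) ^ 4) = (((P : ℝ) ^ 4 : ℝ) : ℂ) from by push_cast; ring, Complex.re_ofReal_mul]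
    rw [norm_mul, Complex.norm_exp, hre, ← Real.exp_log (norm_pos_iff.2 hz0'), ← Real.exp_add]
    exact Real.exp_le_exp.2 (abs_le.1 hzb').2

/-- E-data (channel through `0`, `f 0 = 0`, envelope) ⇒ the crux's conclusion at `(β, ρ)`, every `ρ > 0`
(sorry-free): `x := 0`, where the floor is free (`Z_P 0 = 1`, `f 0 = 0`), then `windowAt_of_envelopeFloor` with the
proved anchor. -/
theorem windowAt_of_envelope (G : Type) [Group G] [TopologicalSpace G] [IsTopologicalGroup G] [CompactSpace G]
    [MeasurableSpace G] [BorelSpace G]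
    (hG : Literature.MathematicalPhysics.QuantumFieldTheory.IsCompactSimpleLieGroup G)
    (r : Literature.MathematicalPhysics.QuantumFieldTheory.LatticeRep G)
    {D : Set ℂ} (hDo : IsOpen D) (hDc : IsConnected D) (h0D : (0 : ℂ) ∈ D) {β : ℝ} (hβD : (β : ℂ) ∈ D)
    {f : ℂ → ℂ} (hf : DifferentiableOn ℂ f D) (hf0 : f 0 = 0) {M : ℝ} {P₀ : ℕ}
    (henv : ∀ P : ℕ, P₀ ≤ P → ∀ z ∈ D,
      ‖Literature.MathematicalPhysics.QuantumFieldTheory.wilsonFinTorusPartitionC r.ρ z P P P P *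
        Complex.exp ((P : ℂ) ^ 4 * f z)‖ ≤ Real.exp M)
    {ρ : ℝ} (hρ : 0 < ρ) :
    ∃ D' : Set ℂ, IsOpen D' ∧ IsConnected D' ∧ (β : ℂ) ∈ D' ∧ (∃ x : ℝ, |x| < ρ ∧ (x : ℂ) ∈ D') ∧
      ∃ g : ℂ → ℂ, DifferentiableOn ℂ g D' ∧ ∃ M' : ℝ, ∃ P₁ : ℕ, ∀ P : ℕ, P₁ ≤ P → ∀ z ∈ D',
        Literature.MathematicalPhysics.QuantumFieldTheory.wilsonFinTorusPartitionC r.ρ z P P P P ≠ 0 ∧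
        |Real.log ‖Literature.MathematicalPhysics.QuantumFieldTheory.wilsonFinTorusPartitionC r.ρ z P P P P‖ +
          (P : ℝ) ^ 4 * (g z).re| ≤ M' := by
  obtain ⟨ρ₀, hρ₀, c, hc, -, fA, hfA, C, hA⟩ :=
    Summit.QuantumFields.YangMills.Theorems.complexStrongCouplingAnchor_proof G hG r
  have h0ρ₀ : |(0 : ℝ)| < ρ₀ := by simpa using hρ₀
  have h0D' : ((0 : ℝ) : ℂ) ∈ D := by simpa using h0D
  have hfl : ∀ P : ℕ, P₀ ≤ P →
      -max M 0 ≤ Real.log ‖Literature.MathematicalPhysics.QuantumFieldTheory.wilsonFinTorusPartitionC r.ρ ((0 : ℝ) : ℂ) P P P P‖ +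
        (P : ℝ) ^ 4 * (f ((0 : ℝ) : ℂ)).re := by
    intro P _
    rw [Complex.ofReal_zero, Literature.MathematicalPhysics.QuantumFieldTheory.wilsonFinTorusPartitionC_zero, hf0]
    simp only [norm_one, Real.log_one, Complex.zero_re, mul_zero, add_zero, Left.neg_nonpos_iff]
    exact le_max_right _ _
  have henv' : ∀ P : ℕ, P₀ ≤ P → ∀ z ∈ D,
      ‖Literature.MathematicalPhysics.QuantumFieldTheory.wilsonFinTorusPartitionC r.ρ z P P P P *
        Complex.exp ((P : ℂ) ^ 4 * f z)‖ ≤ Real.exp (max M 0) :=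
    fun P hP z hz => (henv P hP z hz).trans (Real.exp_le_exp.2 (le_max_left _ _))
  obtain ⟨D', hD'D, hD'o, hD'c, hβD', hxD', P₁, hwin⟩ :=
    windowAt_of_envelopeFloor G r ⟨c, hc, fA, hfA, C, fun P hP z hz => hA P hP z hz⟩ hDo hDc hβD h0ρ₀ h0D'
      hf hfl henv'
  exact ⟨D', hD'o, hD'c, hβD', ⟨0, by simpa using hρ, hxD'⟩, f, hf.mono hD'D, 1, P₁, hwin⟩

/-- **The envelope criterion** (registered stub `stub_envelopeCriterion` of line `Sketch`).  (1) The crux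
`FreeEnergyWindowChannel` is EQUIVALENT to the one-sided statement C⁺⁺ (floor at the real point `x` + envelope on
the channel): `→` is bookkeeping (`‖Z e^{P⁴ f}‖ = exp (log ‖Z‖ + P⁴ Re f)`), `←` feeds C⁺⁺ with `ρ ⊓ ρ₀/2` (so
that `x` lies in the disc of the proved anchor) and applies `windowAt_of_envelopeFloor`.  (2) The pure envelope
statement E (channel through `0`, `f 0 = 0`) implies the crux (`windowAt_of_envelope`, `x := 0`). -/
theorem stub_envelopeCriterion :
    (Summit.QuantumFields.YangMills.Theses.ComplexCouplingChannel.FreeEnergyWindowChannel ↔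
    (∀ (G : Type) [Group G] [TopologicalSpace G] [IsTopologicalGroup G] [CompactSpace G] [MeasurableSpace G] [BorelSpace G], Literature.MathematicalPhysics.QuantumFieldTheory.IsCompactSimpleLieGroup G → ∀ r : Literature.MathematicalPhysics.QuantumFieldTheory.LatticeRep G,
      ∃ β₁ : ℝ, ∀ β : ℝ, β₁ ≤ β → ∀ ρ : ℝ, 0 < ρ →
        ∃ D : Set ℂ, IsOpen D ∧ IsConnected D ∧ (β : ℂ) ∈ D ∧
          ∃ x : ℝ, |x| < ρ ∧ (x : ℂ) ∈ D ∧
          ∃ f : ℂ → ℂ, DifferentiableOn ℂ f D ∧ ∃ M : ℝ, ∃ P₀ : ℕ,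
            (∀ P : ℕ, P₀ ≤ P →
              -M ≤ Real.log ‖Literature.MathematicalPhysics.QuantumFieldTheory.wilsonFinTorusPartitionC r.ρ (x : ℂ) P P P P‖ +
                (P : ℝ) ^ 4 * (f (x : ℂ)).re) ∧
            ∀ P : ℕ, P₀ ≤ P → ∀ z ∈ D,
              ‖Literature.MathematicalPhysics.QuantumFieldTheory.wilsonFinTorusPartitionC r.ρ z P P P P *
                Complex.exp ((P : ℂ) ^ 4 * f z)‖ ≤ Real.exp M)) ∧
    ((∀ (G : Type) [Group G] [TopologicalSpace G] [IsTopologicalGroup G] [CompactSpace G] [MeasurableSpace G] [BorelSpace G], Literature.MathematicalPhysics.QuantumFieldTheory.IsCompactSimpleLieGroup G → ∀ r : Literature.MathematicalPhysics.QuantumFieldTheory.LatticeRep G,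
      ∃ β₁ : ℝ, ∀ β : ℝ, β₁ ≤ β →
        ∃ D : Set ℂ, IsOpen D ∧ IsConnected D ∧ (0 : ℂ) ∈ D ∧ (β : ℂ) ∈ D ∧
          ∃ f : ℂ → ℂ, DifferentiableOn ℂ f D ∧ f 0 = 0 ∧ ∃ M : ℝ, ∃ P₀ : ℕ,
            ∀ P : ℕ, P₀ ≤ P → ∀ z ∈ D,
              ‖Literature.MathematicalPhysics.QuantumFieldTheory.wilsonFinTorusPartitionC r.ρ z P P P P *
                Complex.exp ((P : ℂ) ^ 4 * f z)‖ ≤ Real.exp M) →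
      Summit.QuantumFields.YangMills.Theses.ComplexCouplingChannel.FreeEnergyWindowChannel) := by
  refine ⟨⟨envelopeFloor_of_crux, fun h => ?_⟩, fun h => ?_⟩
  · intro G _ _ _ _ _ _ hG r Zc
    obtain ⟨ρ₀, hρ₀, c, hc, -, fA, hfA, C, hA⟩ :=
      Summit.QuantumFields.YangMills.Theorems.complexStrongCouplingAnchor_proof G hG r
    obtain ⟨β₁, hβ₁⟩ := h G hG r
    refine ⟨β₁, fun β hβ ρ hρ => ?_⟩
    obtain ⟨D, hDo, hDc, hβD, x, hxρ, hxD, f, hf, M, P₀, hfl, henv⟩ :=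
      hβ₁ β hβ (min ρ (ρ₀ / 2)) (lt_min hρ (half_pos hρ₀))
    have hxρ' : |x| < ρ := lt_of_lt_of_le hxρ (min_le_left _ _)
    have hxρ₀ : |x| < ρ₀ := by linarith [lt_of_lt_of_le hxρ (min_le_right _ _)]
    obtain ⟨D', hD'D, hD'o, hD'c, hβD', hxD', P₁, hwin⟩ :=
      windowAt_of_envelopeFloor G r ⟨c, hc, fA, hfA, C, fun P hP z hz => hA P hP z hz⟩ hDo hDc hβD hxρ₀ hxD
        hf hfl henv
    exact ⟨D', hD'o, hD'c, hβD', ⟨x, hxρ', hxD'⟩, f, hf.mono hD'D, 1, P₁, fun P hP z hz => hwin P hP z hz⟩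
  · intro G _ _ _ _ _ _ hG r Zc
    obtain ⟨β₁, hβ₁⟩ := h G hG r
    refine ⟨β₁, fun β hβ ρ hρ => ?_⟩
    obtain ⟨D, hDo, hDc, h0D, hβD, f, hf, hf0, M, P₀, henv⟩ := hβ₁ β hβ
    obtain ⟨D', hD'o, hD'c, hβD', hx, g, hg, M', P₁, hwin⟩ :=
      windowAt_of_envelope G hG r hDo hDc h0D hβD hf hf0 henv hρ
    exact ⟨D', hD'o, hD'c, hβD', hx, g, hg, M', P₁, fun P hP z hz => hwin P hP z hz⟩

end Summit.QuantumFields.YangMills.Theorems.FreeEnergyWindowChannel
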